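import Summits.BirchSwinnertonDyer.BirchSwinnertonDyer.Theorems.SchneiderFreeAdditiveX3KYBranchHalves
import HarnessLib

/-!
# Route `SchneiderFreeAdditiveX3` (K1 door) — the WING (`SchneiderFreeAdditiveX3Upper`, crux r3 `GordTwoBranchCoIMCField`) on the
# two printed halves of Keller–Yin Thm. 3.5.1: by name through the proved glue, and SHARPER — [DIV] (Thm. 3.3.6 ∘ Prop. 3.4.4)
# and the clause `μ(𝔛) = 0` ONLY

Cell `bsd-schneider-ideate`, seat `bsd-schneider-door-c5` (prover, generation 22; assembly layer; `--supports` 19177 / wing 20365).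
PARTITION: board row B6 ∩ X3 ∩ sst-twist, `r = 1`, (G-ord, `e = 2`) half (2 560 of 7 101 pairs) of `Rank1Residual.partition`;
types-the-object-of nothing new; SHRINKS the wing's preprint input from "Keller–Yin Thm. 3.5.1 (iii)" to "[DIV] + `μ(𝔛) = 0`"; closes
none of B6's cells (BSD NOT advanced).  bears_on: K1-wing (20365 r3) + K1-door (19177).

WHAT (sibling of `…KYBranchHalves.lean`, whose §1 proves `thm351_charIdeal_eq_branch_OPEN ⟸ [DIV] ∧ [INV]`):
* §3(a) the wing crux r3 BY NAME on {[DIV], [INV]} through that glue (gen 20's `gordTwoBranchCoIMCField_of_…_KY_branch_…`);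
* §3(b) SHARPER, per datum: gen 20's `span_le_xac_charIdeal_map_of_KY_branch_of_castellaHsieh_signed` (`(Q) ⊆ Ch_Λ(X_ac^∅)·𝓞_{ℂ_p}⟦T⟧`
  at every ♭-frame of the conjugate prime) with its step 2 — the full equality — REPLACED by [DIV]'s `p^k·L ∈ Ch·R₀⟦T⟧` sharpened by
  `μ(𝔛) = 0` (`KYBranchHalves.span_le_charIdeal_map_of_C_pow_mul_mem`: the generator read in `R₀⟦T⟧` has a unit coefficient, so the
  slack cancels — X1's `exists_mul_eq_of_mul_eq_C_pow_mul`); NO `λ`-input, NO analytic `μ`; (b′) the field-local co-socket and (b″) the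
  wing crux BY NAME from [DIV] ∧ [INV] with [INV] consumed ONLY through its clause `μ(𝔛) = 0`.
INPUT LEDGER of the wing's (G-ord) upper half after this file: PUBLISHED (Kolyvagin, modularity, Hsieh 2014 Thm. A, LZZ 2018, Castella–Hsieh
signed existence) + Keller–Yin {Thm. 3.3.6 ∘ Prop. 3.4.4, "`μ(𝔛) = 0`"} (PREPRINT) — the `λ`-equality and "`μ(𝓛_ε) = 0`" are NOT used upstairs.
HONEST FRAMING: THEOREMS ONLY; composition of tree theorems + the sibling's unconditional algebra; CONDITIONAL on the displayed hypotheses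
(Keller–Yin arXiv:2410.23241 is an unrefereed PREPRINT); nothing is closed by me; BSD is proved for no curve; «closes rung: none».
References: [KellerYin2024b] arXiv:2410.23241 Thm. 3.3.6, Prop. 3.4.4, §3.5, Thm. 3.5.1 (preprint); [CastellaHsieh2018] §3.3, Def. 3.7,
Prop. 3.8; [Hsieh2014] Thm. A; [LiuZhangZhang2018] Thm 1.5.1/1.5.3; [Washington1997] §7.1, §13.2; [Castella2018] Thm. 3.1.
-/

set_option autoImplicit false
-- `Summit.<P>.<Sub>` repeats `BirchSwinnertonDyer` by the tree's layout convention (D-0017)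
set_option linter.dupNamespace false

noncomputable section

open scoped Classical NumberField

open Field NumberField IsDedekindDomain WeierstrassCurve PowerSeries
  Literature.NumberTheory.EllipticCurves Literature.NumberTheory.EllipticCurves.GreenbergSelmer
  Literature.NumberTheory.GaloisRepresentations Literature.NumberTheory.GaloisCohomology
  Literature.NumberTheory.EllipticCurves.ModularForms Literature.NumberTheory.EllipticCurves.Rank1Residual
  Literature.NumberTheory.EllipticCurves.Rank1Residual.Typed
  Literature.NumberTheory.EllipticCurves.KellerYin2024 Literature.NumberTheory.EllipticCurves.CaiShuTian2014
  Summit.BirchSwinnertonDyer.Rank1Residual Summit.BirchSwinnertonDyer.Rank1Residual.X11b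
  Summit.BirchSwinnertonDyer.Rank1Residual.X11b.AcSelmer Summit.BirchSwinnertonDyer.Rank1Residual.X11b.Halves
  Summit.BirchSwinnertonDyer.Rank1Residual.X11b.CongruenceLimit
  Summit.BirchSwinnertonDyer.BirchSwinnertonDyer.Theorems.SchneiderFree
  Summit.BirchSwinnertonDyer.BirchSwinnertonDyer.Theorems.SchneiderFree.Upper
  Summit.BirchSwinnertonDyer.BirchSwinnertonDyer.Theorems.SchneiderFree.KYRead
  Summit.BirchSwinnertonDyer.BirchSwinnertonDyer.Theses.SchneiderFreeAdditiveX3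
  Summit.BirchSwinnertonDyer.BirchSwinnertonDyer.Theorems.SchneiderFreeAdditiveX3.LZZMatch
  Summit.BirchSwinnertonDyer.BirchSwinnertonDyer.Theorems.SchneiderFreeAdditiveX3.ControlDischarged
  Summit.BirchSwinnertonDyer.BirchSwinnertonDyer.Theorems.SchneiderFreeAdditiveX3.KYBranchOnly

-- the wing route's crux r3 decl, by name
open Summit.BirchSwinnertonDyer.BirchSwinnertonDyer.Theses.SchneiderFreeAdditiveX3Upper (GordTwoBranchCoIMCField)

namespace Summit.BirchSwinnertonDyer.BirchSwinnertonDyer.Theorems.SchneiderFreeAdditiveX3.KYBranchHalves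

/-! ### §3 The WING on the halves: (a) by name; (b) sharper — [DIV] and `μ(𝔛) = 0` only, per datum -/

/-- **(a) Wing crux r3 `GordTwoBranchCoIMCField` (item 20365) BY NAME ⇐ Kolyvagin ∧ modularity ∧ Hsieh 2014 Thm. A ∧ LZZ 2018 ∧
Castella–Hsieh signed existence (PUBLISHED) ∧ Keller–Yin [DIV] ∧ [INV] (PREPRINT, two typed sentences)** — gen 20's
`gordTwoBranchCoIMCField_of_hsieh_of_lzz_of_KY_branch_of_castellaHsieh_signed` with `hKYb := §1 hDIV hINV`.  (§3(b) shows that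
of [INV] only the clause `μ(𝔛) = 0` is used.)  CONDITIONAL; the crux stays OPEN (preprint); BSD NOT advanced.
[cite: KellerYin2024b, Thm. 3.3.6, Prop. 3.4.4, Thm. 3.5.1, Rem. 3.5.2 (arXiv:2410.23241 pp. 19–20) (preprint; hypotheses)]
[cite: CastellaHsieh2018, §3.3, Def. 3.7 and Prop. 3.8] [cite: Hsieh2014, Thm. A p. 712 (Doc. Math. 19)]
[cite: LiuZhangZhang2018, Thm 1.5.1 and Thm 1.5.3 (Duke Math. J. 167 pp. 748–749)] -/
theorem gordTwoBranchCoIMCField_of_hsieh_of_lzz_of_KY_halves_of_castellaHsieh_signed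
    (hKo : ∀ (N : ℕ) [NeZero N] (W : WeierstrassCurve ℚ) (K : Type) [Field K] [NumberField K],
      Literature.NumberTheory.EllipticCurves.kolyvagin N W K)
    (hPar : nonempty_modularParametrizationData)
    (hA : Hsieh2014.thmA_exists_isHsiehLFunction_unrPeriod_anyLevel)
    (hL : LiuZhangZhang2018.thm151_thm153_modularCurve_heegnerVector_additive)
    (hDIV : thm336_divisibility_branch_OPEN) (hINV : thm351_invariants_branch_OPEN)
    (hCHσ : castellaHsieh2018_exists_isBranchBDPLFunction_signed) :
    GordTwoBranchCoIMCField :=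
  gordTwoBranchCoIMCField_of_hsieh_of_lzz_of_KY_branch_of_castellaHsieh_signed hKo hPar hA hL
    (thm351_charIdeal_eq_branch_OPEN_of_divisibility_of_invariants hDIV hINV) hCHσ

/-- **(b) H3♭ᵒᵖᶜ at a ♭-frame of the conjugate prime ⇐ Keller–Yin [DIV] (Thm. 3.3.6 ∘ Prop. 3.4.4, PREPRINT) ∧ `μ(𝔛) = 0` AT THE
DATUM ∧ Castella–Hsieh signed existence (PUBLISHED) ∧ branch-vs-flat rigidity** — gen 20's
`span_le_xac_charIdeal_map_of_KY_branch_of_castellaHsieh_signed` with its step 2 (the full equality `thm351_charIdeal_eq_branch_OPEN`)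
REPLACED by the Kolyvagin half sharpened by `μ(𝔛) = 0` (`span_le_charIdeal_map_of_C_pow_mul_mem`: the generator of
`Ch_Λ(𝔛)` read in `R₀⟦T⟧` has a unit coefficient, so the slack `p^k` of [DIV] cancels — NO `λ`-input, NO analytic `μ`).
For the presented curve `W = C₂ • ((D • W′) ⊗ χ_{p*})` carrying Keller–Yin's per-curve hypotheses, at a socket datum with `d_K`
odd `≠ −3`, the socket's degree-one `𝔭`, a second degree-one `𝔭′ ≠ 𝔭` above `p`, `ι′` inducing it, and
`μ(X_ac^∅(W_K) at 𝔭) = 0`: for EVERY ♭-frame `Q` of `Dt.f` at `(ι′, 𝔭′)`, `(Q) ⊆ Ch_Λ(X_ac^∅(W_K) at 𝔭)·𝓞_{ℂ_p}⟦T⟧`.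
CONDITIONAL on the named facts and the displayed `μ`-hypothesis; nothing asserted about BSD.
[cite: KellerYin2024b, Thm. 3.3.6 and Prop. 3.4.4 (arXiv:2410.23241 p. 19) (preprint; hypotheses)]
[cite: CastellaHsieh2018, §3.3, Def. 3.7 and Prop. 3.8 (the signed branch frame)] [cite: Washington1997, §7.1 and §13.2] -/
theorem span_le_xac_charIdeal_map_of_KY_divisibility_of_muInvariant_eq_zero
    (hCHσ : castellaHsieh2018_exists_isBranchBDPLFunction_signed) (hDIV : thm336_divisibility_branch_OPEN)
    (hmodN : exists_isNewformOf)
    -- the prime, the good partner `W′`, the presentation of the door's curve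
    {p : ℕ} [hp : Fact p.Prime] (hp2 : p ≠ 2) (W' : WeierstrassCurve ℚ) [W'.IsElliptic]
    (hgood : W'.HasGoodReductionAtPrime p) (D C₂ : VariableChange ℚ)
    [(C₂ • (D • W').quadraticTwist ((-1 : ℚ) ^ (p / 2) * p)).IsElliptic]
    [(C₂ • (D • W').quadraticTwist ((-1 : ℚ) ^ (p / 2) * p)).IsGloballyMinimal] {N : ℕ} [NeZero N]
    (Dt : ModularParametrizationData (C₂ • (D • W').quadraticTwist ((-1 : ℚ) ^ (p / 2) * p)) N)
    {N' : ℕ} [NeZero N'] (Dt' : ModularParametrizationData W' N') (hpN' : ¬ p ∣ N')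
    -- the socket's field, tower, primes, embedding datum; Heegner for `N` and for the partner's level
    {K : Type} [Field K] [NumberField K] [IsGalois ℚ K] (hK : IsImaginaryQuadratic K)
    (hHe : SatisfiesHeegnerHypothesis N K) (hHe' : SatisfiesHeegnerHypothesis N' K)
    (hodd : Odd (NumberField.discr K)) (hdK : NumberField.discr K ≠ -3)
    {κ : ZpExtension K p} (hκ : κ.IsAnticyclotomic) (γ : absoluteGaloisGroup K) [hγ : Fact (κ.IsTopGenerator γ)]
    {𝔭 : HeightOneSpectrum (𝓞 K)} (h𝔭 : ((p : ℕ) : 𝓞 K) ∈ 𝔭.asIdeal)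
    (he : 𝔭.asIdeal.ramificationIdx (𝓞 ℚ) = 1) (hf : 𝔭.asIdeal.inertiaDeg (𝓞 ℚ) = 1)
    {𝔭' : HeightOneSpectrum (𝓞 K)} (h𝔭' : ((p : ℕ) : 𝓞 K) ∈ 𝔭'.asIdeal) (hne : 𝔭 ≠ 𝔭')
    {ι' : PadicAlgCl p ≃+* ℂ} (hι' : BranchInducesPrime p ι' 𝔭')
    -- Keller–Yin's per-curve hypotheses for the presented curve ITSELF
    (hN : (C₂ • (D • W').quadraticTwist ((-1 : ℚ) ^ (p / 2) * p)).conductorNorm ℤ = N)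
    (hcase : (C₂ • (D • W').quadraticTwist ((-1 : ℚ) ^ (p / 2) * p)).HasGoodOrdinaryReductionOverQuadraticAt p)
    (hred : Red (C₂ • (D • W').quadraticTwist ((-1 : ℚ) ^ (p / 2) * p)) p)
    (hlat : ∃ Φ : AddSubgroup (geomTorsion (C₂ • (D • W').quadraticTwist ((-1 : ℚ) ^ (p / 2) * p)) (p : ℤ)),
      IsRationalLine (C₂ • (D • W').quadraticTwist ((-1 : ℚ) ^ (p / 2) * p)) p Φ ∧
        ¬ LineDecompositionTrivialAt (C₂ • (D • W').quadraticTwist ((-1 : ℚ) ^ (p / 2) * p)) p Φ)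
    (htf : ∀ Q : ((C₂ • (D • W').quadraticTwist ((-1 : ℚ) ^ (p / 2) * p)).baseChange K).toAffine.Point,
      p • Q = 0 → Q = 0)
    -- the algebraic `μ`-invariant of the Greenberg Selmer dual at `(v, v̄) = (𝔭′, 𝔭)` vanishes (Keller–Yin [INV], clause `μ(𝔛) = 0`)
    (hμX : muInvariant p (Literature.NumberTheory.EllipticCurves.Castella2018.AcSelmer.XAc
      ((C₂ • (D • W').quadraticTwist ((-1 : ℚ) ^ (p / 2) * p)).baseChange K) p κ 𝔭 ∅ γ) = 0)
    -- the ♭-frame at the conjugate prime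
    {ΩK' : ℂ} {Ωp' : ℂ_[p]} {Q : PowerSeries (PadicComplexInt p)} (hΩK' : ΩK' ≠ 0) (hΩp' : Ωp' ≠ 0)
    (hQ : R1.IsBDPLFunctionInt p ι' 𝔭' κ γ Dt.f ΩK' Ωp' Q) :
    Ideal.span {Q} ≤ (XAc.charIdeal ((C₂ • (D • W').quadraticTwist ((-1 : ℚ) ^ (p / 2) * p)).baseChange K) p κ 𝔭 ∅ γ).map
        (PowerSeries.map (R1.toCpInt p)) := by
  have hsplit : ((Ideal.span {(p : ℤ)}).primesOver (𝓞 K)).ncard = 2 :=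
    ncard_primesOver_eq_two_of_degreeOne hK.1 h𝔭 he hf
  have hcond : ∀ 𝔮 : HeightOneSpectrum (𝓞 K), ((p : ℕ) : 𝓞 K) ∈ 𝔮.asIdeal →
      (KellerYin2024.genusHeckeCharacter K p).HasConductorExponentAt 𝔮 1 := fun 𝔮 h𝔮 ↦
    KellerYin2024.genusHeckeCharacter_hasConductorExponentAt_one_of_split K p hp2 hK hsplit h𝔮
  -- step 1: the SIGNED branch frame of `(Dt′.f, χ_ε)` at `𝔭′`
  obtain ⟨e, ΩK, Ωp, L, hesign, hΩK, hL⟩ := hCHσ ι' W' K 𝔭' κ γ Dt'.isNewformOf (KellerYin2024.genusHeckeCharacter K p) hp2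
    hpN' hK hodd hdK hsplit h𝔭' hι' hHe' hκ hγ.out (KellerYin2024.genusHeckeCharacter_sq K p)
    (fun w hw ↦ KellerYin2024.genusHeckeCharacter_isUnramifiedAt K p hw) hcond
  have he0 : e ≠ 0 := by rcases hesign with rfl | rfl <;> norm_num
  have hΩp : ((Ωp : unrIntegers p) : ℂ_[p]) ≠ 0 := by
    rw [Ne, ZeroMemClass.coe_eq_zero]
    exact Ωp.ne_zero
  -- step 2: Keller–Yin [DIV] at `(v, v̄) = (𝔭′, 𝔭)` for the presented curve itself: `𝔛` torsion, `p^k·L ∈ Ch·R₀⟦T⟧`;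
  -- with `μ(𝔛) = 0` the slack cancels: `(L) ⊆ Ch·R₀⟦T⟧`
  have hS : PotOrdSetting ι' (C₂ • (D • W').quadraticTwist ((-1 : ℚ) ^ (p / 2) * p)) K 𝔭' 𝔭 κ N :=
    potOrdSetting_of_socketData hp2 ι' _ K 𝔭 𝔭' κ N hN hcase hred hlat htf hK hHe hodd hdK hκ h𝔭 he hf hne hι'
  have htw : ∃ S : Finset ℕ, ∀ ℓ : ℕ, ℓ.Prime → ℓ ∉ S →
      cuspCoeff Dt.f ℓ = ((legendreSym p ℓ : ℤ) : ℂ) * cuspCoeff Dt'.f ℓ :=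
    exists_cofinite_cuspCoeff_eq_legendreSym_mul hp2 W' D C₂ Dt Dt'
  obtain ⟨hT, hdiv⟩ := hDIV ι' _ K 𝔭' 𝔭 κ γ Dt.isNewformOf hS Dt'.isNewformOf.1 hpN' htw
  obtain ⟨k, hk⟩ := hdiv e ΩK ((Ωp : unrIntegers p) : ℂ_[p]) L he0 hΩK hΩp hL (toUnr p) (coe_toUnr p)
  haveI : Module.Finite (IwasawaAlgebra p) (Literature.NumberTheory.EllipticCurves.Castella2018.AcSelmer.XAc
      ((C₂ • (D • W').quadraticTwist ((-1 : ℚ) ^ (p / 2) * p)).baseChange K) p κ 𝔭 ∅ γ) :=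
    Literature.NumberTheory.EllipticCurves.Castella2018.AcSelmer.XAc.module_finite_empty _ p κ 𝔭 γ
  have h1 : Ideal.span {L} ≤ (XAc.charIdeal ((C₂ • (D • W').quadraticTwist ((-1 : ℚ) ^ (p / 2) * p)).baseChange K)
      p κ 𝔭 ∅ γ).map (PowerSeries.map (toUnr p)) := by
    rw [xac_charIdeal_eq_literature]
    exact span_le_charIdeal_map_of_C_pow_mul_mem _ hT hμX (toUnr p) (coe_toUnr p) hk
  have h2 := span_le_map_toCpInt_of_span_le_map_toUnr h1
  -- step 3: rigidity — `(Q) ⊆ (L)` since the constant `ι′⁻¹(±1)` is co-integral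
  have hKp : Algebra.IsUnramifiedIn (𝓞 K) (Ideal.span {(p : ℤ)}) := isUnramifiedIn_of_splitsTwo hK hsplit
  obtain ⟨c', -, hc'⟩ := exists_coe_eq_symm_of_sign (p := p) (ι := ι') hesign
  have h4 : Ideal.span {Q} ≤ Ideal.span {PowerSeries.map (R1.unrToCpInt p) L} :=
    span_le_span_map_of_isBranchBDPLFunction_of_isBDPLFunctionInt hp2 hK hKp Dt.f Dt'.f
      (fun _ hℓ hℓp ↦ cuspCoeff_eq_legendreSym_mul_of_presentation hp2 W' D C₂ Dt.isNewformOf Dt'.isNewformOf hℓ hℓp)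
      (cuspCoeff_prime_eq_zero_of_presentation hp2 W' hgood D C₂ Dt)
      (prime_dvd_level_of_presentation hmodN hp2 W' hgood D C₂ Dt)
      (fun _ hℓ hℓp ↦ dvd_level_iff_dvd_level_partner_of_presentation hmodN hp2 W' hgood D C₂ Dt Dt' hℓ hℓp)
      hκ hγ.out hΩK hΩK' hΩp hΩp' hL hQ hc'
  exact h4.trans h2

/-- **(b′) The field-local (G-ord, `e = 2`) co-socket at a field with `d_K ≠ −3` ⇐ Kolyvagin ∧ modularity ∧ Hsieh 2014 Thm A ∧
LZZ 2018 ∧ Castella–Hsieh signed existence (PUBLISHED) ∧ Keller–Yin [DIV] ∧ [INV] with [INV] entering ONLY through its clause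
`μ(𝔛) = 0`** — gen 20's `additiveIMCUpperBDPInputManinAtField_of_…` re-run on §3(b).  Per datum: present the curve through its
good-ordinary partner; Case (I) from `SubGordTwo`, `Red` from the rational line; the co-divisibility at every ♭-frame of the
conjugate prime from §3(b).  NO value node, NO sliver, NO analytic `μ`, NO `λ`.  CONDITIONAL; nothing asserted about BSD.
[cite: KellerYin2024b, Thm. 3.3.6, Prop. 3.4.4 and Thm. 3.5.1 first sentence (arXiv:2410.23241 pp. 19–20) (preprint; hypotheses)]
[cite: CastellaHsieh2018, §3.3, Def. 3.7 and Prop. 3.8] [cite: Hsieh2014, Thm. A p. 712 (Doc. Math. 19)]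
[cite: LiuZhangZhang2018, Thm 1.5.1 and Thm 1.5.3 (Duke Math. J. 167 pp. 748–749)] [cite: AtkinLehner1970, Thm. 4] -/
theorem additiveIMCUpperBDPInputManinAtField_of_hsieh_of_lzz_of_KY_divisibility_of_muX_of_castellaHsieh_signed
    (hKo : ∀ (N : ℕ) [NeZero N] (W : WeierstrassCurve ℚ) (K : Type) [Field K] [NumberField K],
      Literature.NumberTheory.EllipticCurves.kolyvagin N W K)
    (hPar : nonempty_modularParametrizationData)
    (hA : Hsieh2014.thmA_exists_isHsiehLFunction_unrPeriod_anyLevel)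
    (hL : LiuZhangZhang2018.thm151_thm153_modularCurve_heegnerVector_additive)
    (hDIV : thm336_divisibility_branch_OPEN) (hINV : thm351_invariants_branch_OPEN)
    (hCHσ : castellaHsieh2018_exists_isBranchBDPLFunction_signed)
    {W : WeierstrassCurve ℚ} [W.IsElliptic] [W.IsGloballyMinimal] {p : ℕ} [Fact p.Prime]
    (hp2 : p ≠ 2) (hX : ClassX3 W p) (hSG : Additive.SubGordTwo W p)
    (hlat : ∃ Φ : AddSubgroup (geomTorsion W (p : ℤ)), IsRationalLine W p Φ ∧ ¬ LineDecompositionTrivialAt W p Φ)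
    (K : Type) [Field K] [NumberField K] (hdK : NumberField.discr K ≠ -3) :
    AdditiveIMCUpperBDPInputManinAtField W p K := by
  have hp : p.Prime := Fact.out
  -- Case (I) and reducibility for the curve itself (KY's per-curve hypotheses; `hlat` is given)
  have hcase : W.HasGoodOrdinaryReductionOverQuadraticAt p :=
    hasGoodOrdinaryReductionOverQuadraticAt_of_subGordTwo hp2 W hX hSG
  obtain ⟨Φ₀, hΦ₀, -⟩ := id hlat
  have hred : Red W p := red_of_isRationalLine hΦ₀
  -- present the door's curve through its good-ordinary partner
  obtain ⟨W', hE', hmin', C₂, hW, hord, hΔ⟩ :=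
    exists_goodOrd_partner_presentation_of_subGordTwo_odd hp2 W hX hSG
  subst hW
  haveI : NeZero (W'.conductorNorm ℤ) := ⟨(WeierstrassCurve.conductorNorm_pos_holds W').ne'⟩
  intro N _ Dt H ι P hr' hloc hN hK hodd hunit hHe hL1 hP hnt htf κ hκ γ _ 𝔭 h𝔭 he hf
  refine additiveIMCUpperBDPOnTreeLeAt_of_kolyvagin_of_hsieh_of_lzz_of_intCoDivConj hKo hA hL hp2 hX (Or.inr hSG) Dt H ι P
    hr' hloc hN hK hodd hunit hHe hL1 hP hnt κ hκ γ 𝔭 h𝔭 he hf ?_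
  intro 𝔮 h𝔮 hne he' hf' ι' hι' ΩK Ωp Q hΩK hΩp hQ
  -- a parametrisation datum of the partner; `K/ℚ` is Galois
  obtain ⟨Dt'⟩ := hPar W'
  haveI : IsGalois ℚ K := Literature.FieldTheory.Galois.isGalois_of_finrank_eq_two hK.1
  -- the partner's level is prime to `p` and inherits the Heegner hypothesis (`N_{W′} ∣ N`)
  have hpN' : ¬ p ∣ W'.conductorNorm ℤ := not_dvd_conductorNorm_of_hasGoodReductionAtPrime W' hord.1
  have hmodN : exists_isNewformOf := exists_isNewformOf_of_nonempty_modularParametrizationData hPar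
  have hHe' : SatisfiesHeegnerHypothesis (W'.conductorNorm ℤ) K :=
    SatisfiesHeegnerHypothesis.of_dvd (conductorNorm_partner_dvd_level hmodN hp2 W' hord.1 _ C₂ Dt) hHe
  -- Keller–Yin [INV], clause `μ(𝔛) = 0`, at `(v, v̄) = (𝔮, 𝔭)` for the presented curve itself
  have hS : PotOrdSetting ι' _ K 𝔮 𝔭 κ N :=
    potOrdSetting_of_socketData hp2 ι' _ K 𝔭 𝔮 κ N hN hcase hred hlat htf hK hHe hodd hdK hκ h𝔭 he hf hne hι'
  have htw : ∃ S : Finset ℕ, ∀ ℓ : ℕ, ℓ.Prime → ℓ ∉ S →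
      cuspCoeff Dt.f ℓ = ((legendreSym p ℓ : ℤ) : ℂ) * cuspCoeff Dt'.f ℓ :=
    exists_cofinite_cuspCoeff_eq_legendreSym_mul hp2 W' _ C₂ Dt Dt'
  have hμX := (hINV ι' _ K 𝔮 𝔭 κ γ Dt.isNewformOf hS Dt'.isNewformOf.1 hpN' htw).1
  exact span_le_xac_charIdeal_map_of_KY_divisibility_of_muInvariant_eq_zero hCHσ hDIV hmodN hp2 W' hord.1 _ C₂ Dt Dt' hpN'
    hK hHe hHe' hodd hdK hκ γ h𝔭 he hf h𝔮 hne hι' hN hcase hred hlat htf hμX hΩK hΩp hQ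

/-- **(b″) Wing crux r3 `GordTwoBranchCoIMCField` (item 20365) BY NAME ⇐ Kolyvagin ∧ modularity ∧ Hsieh 2014 Thm. A ∧ LZZ 2018 ∧
Castella–Hsieh signed existence (all PUBLISHED) ∧ Keller–Yin [DIV] ∧ [INV] — the latter consumed ONLY through `μ(𝔛) = 0`** (§3(b′)).
Same hypotheses BY NAME as §3(a), different (sharper) proof.  CONDITIONAL on the displayed hypotheses; the crux stays OPEN
(preprint); BSD NOT advanced.
[cite: KellerYin2024b, Thm. 3.3.6, Prop. 3.4.4, Thm. 3.5.1 first sentence, Assumption 2.0.3 (arXiv:2410.23241 pp. 8, 19–20) (preprint; hypotheses)]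
[cite: CastellaHsieh2018, §3.3, Def. 3.7 and Prop. 3.8] [cite: Hsieh2014, Thm. A p. 712 (Doc. Math. 19)]
[cite: LiuZhangZhang2018, Thm 1.5.1 and Thm 1.5.3 (Duke Math. J. 167 pp. 748–749)] -/
theorem gordTwoBranchCoIMCField_of_hsieh_of_lzz_of_KY_divisibility_of_muX_of_castellaHsieh_signed
    (hKo : ∀ (N : ℕ) [NeZero N] (W : WeierstrassCurve ℚ) (K : Type) [Field K] [NumberField K],
      Literature.NumberTheory.EllipticCurves.kolyvagin N W K)
    (hPar : nonempty_modularParametrizationData)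
    (hA : Hsieh2014.thmA_exists_isHsiehLFunction_unrPeriod_anyLevel)
    (hL : LiuZhangZhang2018.thm151_thm153_modularCurve_heegnerVector_additive)
    (hDIV : thm336_divisibility_branch_OPEN) (hINV : thm351_invariants_branch_OPEN)
    (hCHσ : castellaHsieh2018_exists_isBranchBDPLFunction_signed) :
    GordTwoBranchCoIMCField := by
  intro W _ _ p _ hp2 hX hSG hlat K _ _ _ hdK
  exact additiveIMCUpperBDPInputManinAtField_of_hsieh_of_lzz_of_KY_divisibility_of_muX_of_castellaHsieh_signed hKo hPar hA hL
    hDIV hINV hCHσ hp2 hX hSG hlat K hdK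

/-! ### §3(c) The wing BY NAME on [DIV] + the frame-free clause "`μ(𝔛) = 0`" (`thm351_muInvariant_eq_zero_OPEN`) — no [INV]
(appended by door-c5 gen 22 once the partner-free clause landed in `…/PotentiallyGoodOrdinaryIwasawaTheoryBranchHalves.lean` §4) -/

/-- **(c′) The field-local (G-ord, `e = 2`) co-socket at a field with `d_K ≠ −3` ⇐ Kolyvagin ∧ modularity ∧ Hsieh 2014 Thm A ∧ LZZ 2018 ∧
Castella–Hsieh signed existence (PUBLISHED) ∧ Keller–Yin [DIV] (Thm. 3.3.6 ∘ Prop. 3.4.4) ∧ [INV.μ] ("`μ(𝔛) = 0`",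
`thm351_muInvariant_eq_zero_OPEN`) — TWO typed sentences, the second frame-free and partner-free** — §3(b′) with the `μ`-input
taken from the stand-alone clause instead of [INV].  NO `λ`, NO analytic `μ`.  CONDITIONAL; nothing asserted about BSD.
[cite: KellerYin2024b, Thm. 3.3.6, Prop. 3.4.4 and Thm. 3.5.1 clause μ(𝔛) = 0 (arXiv:2410.23241 pp. 19–20) (preprint; hypotheses)]
[cite: CastellaHsieh2018, §3.3, Def. 3.7 and Prop. 3.8] [cite: Hsieh2014, Thm. A p. 712 (Doc. Math. 19)]
[cite: LiuZhangZhang2018, Thm 1.5.1 and Thm 1.5.3 (Duke Math. J. 167 pp. 748–749)] [cite: AtkinLehner1970, Thm. 4] -/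
theorem additiveIMCUpperBDPInputManinAtField_of_hsieh_of_lzz_of_KY_divisibility_of_muZero_of_castellaHsieh_signed
    (hKo : ∀ (N : ℕ) [NeZero N] (W : WeierstrassCurve ℚ) (K : Type) [Field K] [NumberField K],
      Literature.NumberTheory.EllipticCurves.kolyvagin N W K)
    (hPar : nonempty_modularParametrizationData)
    (hA : Hsieh2014.thmA_exists_isHsiehLFunction_unrPeriod_anyLevel)
    (hL : LiuZhangZhang2018.thm151_thm153_modularCurve_heegnerVector_additive)
    (hDIV : thm336_divisibility_branch_OPEN) (hμ0 : thm351_muInvariant_eq_zero_OPEN)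
    (hCHσ : castellaHsieh2018_exists_isBranchBDPLFunction_signed)
    {W : WeierstrassCurve ℚ} [W.IsElliptic] [W.IsGloballyMinimal] {p : ℕ} [Fact p.Prime]
    (hp2 : p ≠ 2) (hX : ClassX3 W p) (hSG : Additive.SubGordTwo W p)
    (hlat : ∃ Φ : AddSubgroup (geomTorsion W (p : ℤ)), IsRationalLine W p Φ ∧ ¬ LineDecompositionTrivialAt W p Φ)
    (K : Type) [Field K] [NumberField K] (hdK : NumberField.discr K ≠ -3) :
    AdditiveIMCUpperBDPInputManinAtField W p K := by
  have hp : p.Prime := Fact.out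
  have hcase : W.HasGoodOrdinaryReductionOverQuadraticAt p :=
    hasGoodOrdinaryReductionOverQuadraticAt_of_subGordTwo hp2 W hX hSG
  obtain ⟨Φ₀, hΦ₀, -⟩ := id hlat
  have hred : Red W p := red_of_isRationalLine hΦ₀
  obtain ⟨W', hE', hmin', C₂, hW, hord, hΔ⟩ :=
    exists_goodOrd_partner_presentation_of_subGordTwo_odd hp2 W hX hSG
  subst hW
  haveI : NeZero (W'.conductorNorm ℤ) := ⟨(WeierstrassCurve.conductorNorm_pos_holds W').ne'⟩
  intro N _ Dt H ι P hr' hloc hN hK hodd hunit hHe hL1 hP hnt htf κ hκ γ _ 𝔭 h𝔭 he hf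
  refine additiveIMCUpperBDPOnTreeLeAt_of_kolyvagin_of_hsieh_of_lzz_of_intCoDivConj hKo hA hL hp2 hX (Or.inr hSG) Dt H ι P
    hr' hloc hN hK hodd hunit hHe hL1 hP hnt κ hκ γ 𝔭 h𝔭 he hf ?_
  intro 𝔮 h𝔮 hne he' hf' ι' hι' ΩK Ωp Q hΩK hΩp hQ
  obtain ⟨Dt'⟩ := hPar W'
  haveI : IsGalois ℚ K := Literature.FieldTheory.Galois.isGalois_of_finrank_eq_two hK.1
  have hpN' : ¬ p ∣ W'.conductorNorm ℤ := not_dvd_conductorNorm_of_hasGoodReductionAtPrime W' hord.1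
  have hmodN : exists_isNewformOf := exists_isNewformOf_of_nonempty_modularParametrizationData hPar
  have hHe' : SatisfiesHeegnerHypothesis (W'.conductorNorm ℤ) K :=
    SatisfiesHeegnerHypothesis.of_dvd (conductorNorm_partner_dvd_level hmodN hp2 W' hord.1 _ C₂ Dt) hHe
  -- Keller–Yin's clause `μ(𝔛) = 0` at `(v, v̄) = (𝔮, 𝔭)` for the presented curve itself — frame-free, partner-free
  have hS : PotOrdSetting ι' _ K 𝔮 𝔭 κ N :=
    potOrdSetting_of_socketData hp2 ι' _ K 𝔭 𝔮 κ N hN hcase hred hlat htf hK hHe hodd hdK hκ h𝔭 he hf hne hι'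
  have hμX := hμ0 ι' _ K 𝔮 𝔭 κ γ Dt.isNewformOf hS
  exact span_le_xac_charIdeal_map_of_KY_divisibility_of_muInvariant_eq_zero hCHσ hDIV hmodN hp2 W' hord.1 _ C₂ Dt Dt' hpN'
    hK hHe hHe' hodd hdK hκ γ h𝔭 he hf h𝔮 hne hι' hN hcase hred hlat htf hμX hΩK hΩp hQ

/-- **(c″) Wing crux r3 `GordTwoBranchCoIMCField` (item 20365) BY NAME ⇐ Kolyvagin ∧ modularity ∧ Hsieh 2014 Thm. A ∧ LZZ 2018 ∧
Castella–Hsieh signed existence (all PUBLISHED) ∧ Keller–Yin [DIV] (Thm. 3.3.6 ∘ Prop. 3.4.4) ∧ [INV.μ] "`μ(𝔛) = 0"` (PREPRINT, TWO typed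
sentences)** — the wing's upper half of the K1 rung does NOT use the `λ`-equality nor "`μ(𝓛_ε) = 0`" of Thm. 3.5.1.  CONDITIONAL on the displayed
hypotheses; the crux stays OPEN (preprint); BSD NOT advanced.
[cite: KellerYin2024b, Thm. 3.3.6, Prop. 3.4.4, Thm. 3.5.1 clause μ(𝔛) = 0, Assumption 2.0.3 (arXiv:2410.23241 pp. 8, 19–20) (preprint; hypotheses)]
[cite: CastellaHsieh2018, §3.3, Def. 3.7 and Prop. 3.8] [cite: Hsieh2014, Thm. A p. 712 (Doc. Math. 19)]
[cite: LiuZhangZhang2018, Thm 1.5.1 and Thm 1.5.3 (Duke Math. J. 167 pp. 748–749)] -/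
theorem gordTwoBranchCoIMCField_of_hsieh_of_lzz_of_KY_divisibility_of_muZero_of_castellaHsieh_signed
    (hKo : ∀ (N : ℕ) [NeZero N] (W : WeierstrassCurve ℚ) (K : Type) [Field K] [NumberField K],
      Literature.NumberTheory.EllipticCurves.kolyvagin N W K)
    (hPar : nonempty_modularParametrizationData)
    (hA : Hsieh2014.thmA_exists_isHsiehLFunction_unrPeriod_anyLevel)
    (hL : LiuZhangZhang2018.thm151_thm153_modularCurve_heegnerVector_additive)
    (hDIV : thm336_divisibility_branch_OPEN) (hμ0 : thm351_muInvariant_eq_zero_OPEN)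
    (hCHσ : castellaHsieh2018_exists_isBranchBDPLFunction_signed) :
    GordTwoBranchCoIMCField := by
  intro W _ _ p _ hp2 hX hSG hlat K _ _ _ hdK
  exact additiveIMCUpperBDPInputManinAtField_of_hsieh_of_lzz_of_KY_divisibility_of_muZero_of_castellaHsieh_signed hKo hPar hA hL
    hDIV hμ0 hCHσ hp2 hX hSG hlat K hdK

end Summit.BirchSwinnertonDyer.BirchSwinnertonDyer.Theorems.SchneiderFreeAdditiveX3.KYBranchHalves

end
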